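import Summits.AtomisticToContinuum.BoseEinsteinCondensation.Theorems.BECGroundStateSOSPeriodicIRBoundPFFormUpperBound
import HarnessLib

/-!
# Route `BECGroundStateSOS`, crux `PeriodicIRBound` (stmt-AtomisticToContinuum-3972),
# line `linear-ph-floor-wagner` — stub S-A `stub_fkFormUpperBoundIntegrable`, part 2 (theorem)

Small-time FORM UPPER BOUND of the torus Feynman–Kac pairing (Chung–Zhao (1995), Prop 3.29) for a
real periodic `C¹` function `ψ` when the periodic interaction
`V^per = periodicInteraction v L = ∑_{i<j} v^per(xᵢ - xⱼ)` is only INTEGRABLE on the fundamental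
cell (`∫_cell V^per < ∞`), not bounded:
`‖ψ‖²_cell − ⟨ψ, e^{-tH}ψ⟩_cell ≤ t · (∫_cell |∇ψ|² + ∫_cell V^per ψ² + ε)` for `0 < t < t₀(ε)`.

Sequel of `…PFFormUpperBound.lean` (truncated weight defect, pairing lower bound, shift
invariance lemmas). Here: the potential term
`∫_cell dX E[|ψ(X)| |ψ(B_t)| ∫₀ᵗ V^per(B_s) ds] ≤ t ∫_cell V^per ψ² + K t^{3/2}` with
`K = 3MG · (√2·3N·2) · ∫_cell V^per` (`|ψ(B_t)| ≤ |ψ(X)| + G‖√2 b_t‖`, Tonelli, shift invariance,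
`E‖√2 b_s‖ ≤ √2·3N·2√t`), and the assembly with the free part `sqIncrCell t ψ ≤ 2t ∫_cell |∇ψ|²`
(`PeriodicFeynmanKacFreeForm`): given `ε > 0` take `t₀ = (ε/(K+1))²`.

## References

* K. L. Chung, Z. Zhao, *From Brownian Motion to Schrödinger's Equation* (1995), Thm 3.27,
  Prop 3.29 (81). [ChungZhao1995]
-/

noncomputable section

open scoped BigOperators ENNReal NNReal
open Filter MeasureTheory ProbabilityTheory Set

namespace Summit.AtomisticToContinuum.BoseEinsteinCondensation.Cruxes.PeriodicIRBound.LinearPhFloorWagner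

open Literature.MathematicalPhysics.QuantumManyBody
open Literature.MathematicalPhysics.QuantumManyBody.BoseGas
open Literature.Probability.Process

variable {N : ℕ}

/-! ### The potential term for an integrable periodic interaction -/

/-- **The potential term for an integrable periodic interaction**: for periodic measurable `ψ`
with `|ψ| ≤ M` and Lipschitz constant `G`, and `t > 0`,
`∫_cell dX E[|ψ(X)| |ψ(B_t)| ∫₀ᵗ V^per(B_s) ds] ≤
  t ∫_cell ψ² V^per + t · 3MG (√2·3N·2√t) · ∫_cell V^per`
(`|ψ(B_t)| ≤ |ψ(X)| + G‖√2 b_t‖`, Tonelli, shift invariance of cell integrals of periodic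
functions, `E‖√2 b_s‖ ≤ √2·3N·2√t` for `s ≤ t`). [folklore] -/
theorem lintegral_potential_term_le_of_integrable {v : ℝ → ℝ≥0∞} (hv : Measurable v) {L : ℝ}
    (hL : 0 < L) {ψ : Config N → ℝ} (hψm : Measurable ψ)
    (hper : ∀ (X : Config N) (i : Fin N) (k : Fin 3),
      ψ (X + Pi.single i (EuclideanSpace.single k L)) = ψ X)
    {M : ℝ} (hM : ∀ X, |ψ X| ≤ M) {G : ℝ} (hG : 0 ≤ G) (hLip : ∀ Y Z, |ψ Y - ψ Z| ≤ G * ‖Y - Z‖)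
    {t : ℝ≥0} (ht : t ≠ 0) :
    ∫⁻ X in cellN N L, ∫⁻ ω, ‖ψ X‖ₑ * ‖ψ (X + displacement t ω)‖ₑ * periodicPathAction v L t X ω
        ∂wienerPaths N ∂volume ≤
      ENNReal.ofReal t * (∫⁻ X in cellN N L, ENNReal.ofReal (ψ X ^ 2) * periodicInteraction v L X) +
        ENNReal.ofReal (t * (3 * M * G * (Real.sqrt 2 * ((3 * N : ℕ) * (2 * Real.sqrt t))))) *
          ∫⁻ X in cellN N L, periodicInteraction v L X := by
  have ht' : (0 : ℝ) < t := lt_of_le_of_ne t.coe_nonneg (fun h => ht (by exact_mod_cast h.symm))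
  have hM0 : 0 ≤ M := (abs_nonneg _).trans (hM 0)
  set m : ℝ := Real.sqrt 2 * ((3 * N : ℕ) * (2 * Real.sqrt t)) with hm
  have hm0 : 0 ≤ m := by positivity
  have hVm : Measurable (periodicInteraction (N := N) v L) := measurable_periodicInteraction hv L
  -- the two uses of shift invariance, before naming the cell integrals
  have hcellA : ∀ ω : PathSpace N, ∫⁻ X in cellN N L, periodicPathAction v L t X ω =
      ENNReal.ofReal t * ∫⁻ X in cellN N L, periodicInteraction v L X := fun ω =>
    setLIntegral_cellN_periodicPathAction_eq hv hL t ω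
  have hshift : ∀ h : Config N,
      ∫⁻ X in cellN N L, ENNReal.ofReal (ψ X ^ 2) * periodicInteraction v L (X + h) ≤
        (∫⁻ X in cellN N L, ENNReal.ofReal (ψ X ^ 2) * periodicInteraction v L X) +
          ENNReal.ofReal (G * ‖h‖ * (2 * M)) * ∫⁻ X in cellN N L, periodicInteraction v L X :=
    fun h => setLIntegral_cellN_sq_mul_shift_le_of_bound hL hper hM hG hLip hVm
      (periodicInteraction_add_single v L) h
  set P : ℝ≥0∞ := ∫⁻ X in cellN N L, ENNReal.ofReal (ψ X ^ 2) * periodicInteraction v L X with hP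
  set IV : ℝ≥0∞ := ∫⁻ X in cellN N L, periodicInteraction v L X with hIV
  -- pointwise: `|ψ(B_t)| ≤ |ψ X| + G ‖D_t‖` and `|ψ X| ≤ M`
  have hpt : ∀ (X : Config N) (ω : PathSpace N),
      ‖ψ X‖ₑ * ‖ψ (X + displacement t ω)‖ₑ * periodicPathAction v L t X ω ≤
        ENNReal.ofReal (ψ X ^ 2) * periodicPathAction v L t X ω +
          ENNReal.ofReal M * ENNReal.ofReal G *
            (‖displacement t ω‖ₑ * periodicPathAction v L t X ω) := by
    intro X ω
    have h1 : ‖ψ (X + displacement t ω)‖ₑ ≤ ‖ψ X‖ₑ + ENNReal.ofReal G * ‖displacement t ω‖ₑ := by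
      have := hLip (X + displacement t ω) X
      rw [add_sub_cancel_left] at this
      have h2 : |ψ (X + displacement t ω)| ≤ |ψ X| + G * ‖displacement t ω‖ := by
        linarith [abs_sub_abs_le_abs_sub (ψ (X + displacement t ω)) (ψ X)]
      calc ‖ψ (X + displacement t ω)‖ₑ = ENNReal.ofReal |ψ (X + displacement t ω)| :=
            Real.enorm_eq_ofReal_abs _
        _ ≤ ENNReal.ofReal (|ψ X| + G * ‖displacement t ω‖) := ENNReal.ofReal_le_ofReal h2
        _ = _ := by
            rw [ENNReal.ofReal_add (abs_nonneg _) (by positivity), ENNReal.ofReal_mul hG,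
              ← Real.enorm_eq_ofReal_abs, ofReal_norm]
    have h2 : ‖ψ X‖ₑ ≤ ENNReal.ofReal M := by
      rw [Real.enorm_eq_ofReal_abs]; exact ENNReal.ofReal_le_ofReal (hM X)
    have h3 : ‖ψ X‖ₑ * ‖ψ X‖ₑ = ENNReal.ofReal (ψ X ^ 2) := by
      rw [Real.enorm_eq_ofReal_abs, ← ENNReal.ofReal_mul (abs_nonneg _), ← sq, sq_abs]
    calc ‖ψ X‖ₑ * ‖ψ (X + displacement t ω)‖ₑ * periodicPathAction v L t X ω
        ≤ ‖ψ X‖ₑ * (‖ψ X‖ₑ + ENNReal.ofReal G * ‖displacement t ω‖ₑ) *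
            periodicPathAction v L t X ω := mul_le_mul' (mul_le_mul' le_rfl h1) le_rfl
      _ = ‖ψ X‖ₑ * ‖ψ X‖ₑ * periodicPathAction v L t X ω +
          ‖ψ X‖ₑ * ENNReal.ofReal G * (‖displacement t ω‖ₑ * periodicPathAction v L t X ω) := by
          ring
      _ ≤ _ := add_le_add (by rw [h3]) (mul_le_mul' (mul_le_mul' h2 le_rfl) le_rfl)
  -- part (a): the main term
  have ha : ∫⁻ X in cellN N L, ∫⁻ ω, ENNReal.ofReal (ψ X ^ 2) * periodicPathAction v L t X ω
      ∂wienerPaths N ∂volume ≤ ENNReal.ofReal t * (P + ENNReal.ofReal (G * m * (2 * M)) * IV) := by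
    rw [setLIntegral_cellN_sq_mul_periodicPathAction_eq hv L hψm]
    have hDm : ∀ s : ℝ≥0, Measurable fun ω : PathSpace N => ‖displacement s ω‖ₑ := fun s =>
      (measurable_displacement (N := N) s).enorm
    -- bound the inner double integral uniformly in `s ∈ (0, t]`
    have hinner : ∀ s ∈ Set.Ioc (0 : ℝ) t, ∫⁻ ω, ∫⁻ X in cellN N L, ENNReal.ofReal (ψ X ^ 2) *
        periodicInteraction v L (X + displacement s.toNNReal ω) ∂volume ∂wienerPaths N ≤
        P + ENNReal.ofReal (G * m * (2 * M)) * IV := by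
      intro s hs
      have hs' : s.toNNReal ≤ t := Real.toNNReal_le_iff_le_coe.2 hs.2
      calc ∫⁻ ω, ∫⁻ X in cellN N L, ENNReal.ofReal (ψ X ^ 2) *
            periodicInteraction v L (X + displacement s.toNNReal ω) ∂volume ∂wienerPaths N
          ≤ ∫⁻ ω, (P + ENNReal.ofReal (G * (2 * M)) * IV * ‖displacement s.toNNReal ω‖ₑ)
              ∂wienerPaths N := by
            refine lintegral_mono fun ω => (hshift _).trans (le_of_eq ?_)
            rw [show G * ‖displacement s.toNNReal ω‖ * (2 * M) =
                G * (2 * M) * ‖displacement s.toNNReal ω‖ by ring,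
              ENNReal.ofReal_mul (by positivity : (0 : ℝ) ≤ G * (2 * M)), ofReal_norm]
            ring
        _ = P + ENNReal.ofReal (G * (2 * M)) * IV *
              ∫⁻ ω, ‖displacement s.toNNReal ω‖ₑ ∂wienerPaths N := by
            rw [lintegral_add_left (f := fun _ => P) measurable_const, lintegral_const,
              measure_univ, mul_one, lintegral_const_mul _ (hDm _)]
        _ ≤ P + ENNReal.ofReal (G * (2 * M)) * IV * ENNReal.ofReal m :=
            add_le_add le_rfl (mul_le_mul' le_rfl (lintegral_norm_displacement_le hs'))
        _ = P + ENNReal.ofReal (G * m * (2 * M)) * IV := by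
            rw [show G * m * (2 * M) = G * (2 * M) * m by ring,
              ENNReal.ofReal_mul (by positivity : (0 : ℝ) ≤ G * (2 * M))]
            ring
    calc ∫⁻ s in Set.Ioc (0 : ℝ) t, ∫⁻ ω, ∫⁻ X in cellN N L, ENNReal.ofReal (ψ X ^ 2) *
          periodicInteraction v L (X + displacement s.toNNReal ω) ∂volume ∂wienerPaths N ∂volume
        ≤ ∫⁻ _s in Set.Ioc (0 : ℝ) t, (P + ENNReal.ofReal (G * m * (2 * M)) * IV) ∂volume :=
          setLIntegral_mono measurable_const hinner
      _ = ENNReal.ofReal t * (P + ENNReal.ofReal (G * m * (2 * M)) * IV) := by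
          rw [setLIntegral_const, Real.volume_Ioc, sub_zero, mul_comm]
  -- part (b): the gradient term
  have hb : ∫⁻ X in cellN N L, ∫⁻ ω, ENNReal.ofReal M * ENNReal.ofReal G *
      (‖displacement t ω‖ₑ * periodicPathAction v L t X ω) ∂wienerPaths N ∂volume ≤
      ENNReal.ofReal M * ENNReal.ofReal G * (ENNReal.ofReal m * (ENNReal.ofReal t * IV)) := by
    have hDm : Measurable fun ω : PathSpace N => ‖displacement t ω‖ₑ :=
      (measurable_displacement (N := N) t).enorm
    have hjm : Measurable fun p : Config N × PathSpace N =>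
        ‖displacement t p.2‖ₑ * periodicPathAction v L t p.1 p.2 :=
      (hDm.comp measurable_snd).mul (measurable_periodicPathAction_uncurry hv L t)
    have hjmX : ∀ X : Config N, Measurable fun ω : PathSpace N =>
        ‖displacement t ω‖ₑ * periodicPathAction v L t X ω := fun X =>
      hDm.mul (measurable_periodicPathAction hv L t X)
    have hjmω : ∀ ω : PathSpace N,
        Measurable fun X : Config N => periodicPathAction v L t X ω := by
      intro ω
      have hmq : Measurable fun q : Config N × ℝ =>
          periodicInteraction v L (worldLine q.1 ω q.2.toNNReal) :=
        hVm.comp (measurable_worldLine_prod.comp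
          ((measurable_fst.prodMk measurable_const).prodMk measurable_snd))
      unfold periodicPathAction
      exact hmq.lintegral_prod_right'
    have hjm' : Measurable fun X : Config N =>
        ∫⁻ ω, ‖displacement t ω‖ₑ * periodicPathAction v L t X ω ∂wienerPaths N :=
      hjm.lintegral_prod_right'
    have h2 : ∀ X : Config N, ∫⁻ ω, ENNReal.ofReal M * ENNReal.ofReal G *
        (‖displacement t ω‖ₑ * periodicPathAction v L t X ω) ∂wienerPaths N =
        ENNReal.ofReal M * ENNReal.ofReal G *
          ∫⁻ ω, ‖displacement t ω‖ₑ * periodicPathAction v L t X ω ∂wienerPaths N := fun X =>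
      lintegral_const_mul _ (hjmX X)
    have h3 : ∀ ω : PathSpace N,
        ∫⁻ X in cellN N L, ‖displacement t ω‖ₑ * periodicPathAction v L t X ω =
          ‖displacement t ω‖ₑ * (ENNReal.ofReal t * IV) := fun ω => by
      rw [lintegral_const_mul _ (hjmω ω), hcellA ω]
    have hswap : ∫⁻ X in cellN N L, ∫⁻ ω, ‖displacement t ω‖ₑ * periodicPathAction v L t X ω
        ∂wienerPaths N ∂volume =
        ∫⁻ ω, ∫⁻ X in cellN N L, ‖displacement t ω‖ₑ * periodicPathAction v L t X ω
          ∂volume ∂wienerPaths N :=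
      lintegral_lintegral_swap hjm.aemeasurable
    simp_rw [h2]
    rw [lintegral_const_mul _ hjm', hswap]
    simp_rw [h3]
    rw [lintegral_mul_const _ hDm]
    exact mul_le_mul' le_rfl (mul_le_mul' (lintegral_norm_displacement_le le_rfl) le_rfl)
  -- assemble
  have hmA : ∀ X : Config N, Measurable fun ω : PathSpace N =>
      ENNReal.ofReal (ψ X ^ 2) * periodicPathAction v L t X ω := fun X =>
    (measurable_periodicPathAction hv L t X).const_mul _
  have hmA' : Measurable fun X : Config N => ∫⁻ ω, ENNReal.ofReal (ψ X ^ 2) *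
      periodicPathAction v L t X ω ∂wienerPaths N :=
    ((ENNReal.measurable_ofReal.comp ((hψm.comp measurable_fst).pow_const 2)).mul
      (measurable_periodicPathAction_uncurry hv L t)).lintegral_prod_right'
  have e1 : ENNReal.ofReal t * ENNReal.ofReal (G * m * (2 * M)) =
      ENNReal.ofReal (t * (G * m * (2 * M))) := (ENNReal.ofReal_mul ht'.le).symm
  have e2 : ENNReal.ofReal M * ENNReal.ofReal G * ENNReal.ofReal m * ENNReal.ofReal t =
      ENNReal.ofReal (M * G * m * t) := by
    rw [← ENNReal.ofReal_mul hM0, ← ENNReal.ofReal_mul (by positivity),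
      ← ENNReal.ofReal_mul (by positivity)]
  have e3 : ENNReal.ofReal (t * (G * m * (2 * M))) + ENNReal.ofReal (M * G * m * t) =
      ENNReal.ofReal (t * (3 * M * G * m)) := by
    rw [← ENNReal.ofReal_add (by positivity) (by positivity)]
    congr 1
    ring
  calc ∫⁻ X in cellN N L, ∫⁻ ω, ‖ψ X‖ₑ * ‖ψ (X + displacement t ω)‖ₑ * periodicPathAction v L t X ω
        ∂wienerPaths N ∂volume
      ≤ ∫⁻ X in cellN N L, ∫⁻ ω, (ENNReal.ofReal (ψ X ^ 2) * periodicPathAction v L t X ω +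
          ENNReal.ofReal M * ENNReal.ofReal G *
            (‖displacement t ω‖ₑ * periodicPathAction v L t X ω)) ∂wienerPaths N ∂volume :=
        lintegral_mono fun X => lintegral_mono fun ω => hpt X ω
    _ = (∫⁻ X in cellN N L, ∫⁻ ω, ENNReal.ofReal (ψ X ^ 2) * periodicPathAction v L t X ω
          ∂wienerPaths N ∂volume) +
        ∫⁻ X in cellN N L, ∫⁻ ω, ENNReal.ofReal M * ENNReal.ofReal G *
          (‖displacement t ω‖ₑ * periodicPathAction v L t X ω) ∂wienerPaths N ∂volume := by
        rw [← lintegral_add_left hmA']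
        refine lintegral_congr fun X => ?_
        rw [lintegral_add_left (hmA X)]
    _ ≤ ENNReal.ofReal t * (P + ENNReal.ofReal (G * m * (2 * M)) * IV) +
        ENNReal.ofReal M * ENNReal.ofReal G * (ENNReal.ofReal m * (ENNReal.ofReal t * IV)) :=
        add_le_add ha hb
    _ = ENNReal.ofReal t * P + (ENNReal.ofReal t * ENNReal.ofReal (G * m * (2 * M)) +
          ENNReal.ofReal M * ENNReal.ofReal G * ENNReal.ofReal m * ENNReal.ofReal t) * IV := by
        ring
    _ = ENNReal.ofReal t * P + ENNReal.ofReal (t * (3 * M * G * m)) * IV := by rw [e1, e2, e3]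

/-! ### The form bound -/

/-- **Small-time form upper bound of the torus Feynman–Kac pairing for INTEGRABLE interactions**
(stub S-A of line `linear-ph-floor-wagner`). For `L > 0`, a measurable pair potential `v` whose
periodic interaction `V^per = ∑_{i<j} v^per(xᵢ - xⱼ)` is integrable on the fundamental cell, and a
periodic real `C¹` function `ψ` with `∫_cell V^per ψ² < ∞`: for every `ε > 0` there is `t₀ > 0`
with, for all `0 < t < t₀`,
`‖ψ‖²_cell - ⟨ψ, e^{-tH}ψ⟩_cell ≤ t · (∫_cell |∇ψ|² + ∫_cell V^per ψ² + ε)`.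
This is the upper bound `lim sup t⁻¹⟨ψ - T_tψ, ψ⟩ ≤ 𝓔^per[ψ]` of Chung–Zhao's Prop 3.29 for the
periodic trial class, with the bounded-periodisation hypothesis of `form_upper_bound_periodic`
replaced by integrability (truncated weight defect `1 - w_t ≤ min(A, 1)` and shift invariance of
cell integrals in the remainder terms). [cite: ChungZhao1995, Thm 3.27 and Prop 3.29 (81)] -/
theorem stub_fkFormUpperBoundIntegrable :
    ∀ {N : ℕ} {L : ℝ}, 0 < L → ∀ {v : ℝ → ℝ≥0∞}, Measurable v →
      (∫⁻ X in cellN N L, periodicInteraction v L X) ≠ ⊤ →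
      ∀ {ψ : Config N → ℝ}, ContDiff ℝ 1 ψ →
        (∀ (X : Config N) (i : Fin N) (k : Fin 3),
          ψ (X + Pi.single i (EuclideanSpace.single k L)) = ψ X) →
        (∫⁻ X in cellN N L, ENNReal.ofReal (ψ X ^ 2) * periodicInteraction v L X) ≠ ⊤ →
        ∀ ε : ℝ, 0 < ε → ∃ t₀ : ℝ, 0 < t₀ ∧ ∀ t : ℝ≥0, t ≠ 0 → (t : ℝ) < t₀ →
          (∫ X in cellN N L, ψ X ^ 2) - ∫ X in cellN N L, ψ X * pfkReal v L t ψ X ≤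
            t * ((∫⁻ X in cellN N L, realKinetic ψ X).toReal +
              (∫⁻ X in cellN N L, ENNReal.ofReal (ψ X ^ 2) * periodicInteraction v L X).toReal +
                ε) := by
  intro N L hL v hv hIV ψ hψ hper hpot ε hε
  have hψm : Measurable ψ := hψ.continuous.measurable
  obtain ⟨G, hG, hLip⟩ := exists_lipschitz_of_contDiff_periodic hL hψ hper
  obtain ⟨M, hM0, hM⟩ := exists_bound_of_continuous_periodic hL hψ.continuous hper
  have hkin := setLIntegral_cellN_realKinetic_ne_top hL hψ hper
  set Kin : ℝ≥0∞ := ∫⁻ X in cellN N L, realKinetic ψ X with hKin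
  set P : ℝ≥0∞ := ∫⁻ X in cellN N L, ENNReal.ofReal (ψ X ^ 2) * periodicInteraction v L X with hP
  set IV : ℝ≥0∞ := ∫⁻ X in cellN N L, periodicInteraction v L X with hIVdef
  -- the constant `K` with (potential term) `≤ t P + K t √t`
  set c : ℝ := Real.sqrt 2 * ((3 * N : ℕ) * 2) with hc
  set K : ℝ := 3 * M * G * c * IV.toReal with hK
  have hK0 : 0 ≤ K := by positivity
  refine ⟨(ε / (K + 1)) ^ 2, by positivity, fun t ht htlt => ?_⟩
  have ht' : (0 : ℝ) < t := lt_of_le_of_ne t.coe_nonneg (fun h => ht (by exact_mod_cast h.symm))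
  -- `√t < ε/(K+1)`, so `K √t ≤ ε`
  have hsqrt : Real.sqrt t < ε / (K + 1) := (Real.sqrt_lt' (by positivity)).2 htlt
  have hKε : K * Real.sqrt t ≤ ε := by
    have h1 : K * Real.sqrt t ≤ K * (ε / (K + 1)) := mul_le_mul_of_nonneg_left hsqrt.le hK0
    have h2 : K * (ε / (K + 1)) ≤ ε := by
      rw [mul_div_assoc', div_le_iff₀ (by positivity)]
      nlinarith
    linarith
  -- Step 1: the pairing bound with the truncated action
  have hpair := pairing_lower_bound_min hv hL hψm hper hM t
  -- Step 2: the free term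
  have h1 : (sqIncrCell L t ψ).toReal / 2 ≤ t * Kin.toReal := by
    have hfin : ENNReal.ofReal (2 * t) * Kin ≠ ⊤ := ENNReal.mul_ne_top ENNReal.ofReal_ne_top hkin
    have := ENNReal.toReal_mono hfin (sqIncrCell_le_kinetic hL hψ hper t)
    rw [ENNReal.toReal_mul, ENNReal.toReal_ofReal (by positivity)] at this
    linarith
  -- Step 3: the potential term
  have h2 : (∫⁻ X in cellN N L, ∫⁻ ω, ‖ψ X‖ₑ * ‖ψ (X + displacement t ω)‖ₑ *
      min (periodicPathAction v L t X ω) 1 ∂wienerPaths N ∂volume).toReal ≤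
      t * P.toReal + K * (t * Real.sqrt t) := by
    have hmin : (∫⁻ X in cellN N L, ∫⁻ ω, ‖ψ X‖ₑ * ‖ψ (X + displacement t ω)‖ₑ *
        min (periodicPathAction v L t X ω) 1 ∂wienerPaths N ∂volume) ≤
        ∫⁻ X in cellN N L, ∫⁻ ω, ‖ψ X‖ₑ * ‖ψ (X + displacement t ω)‖ₑ *
          periodicPathAction v L t X ω ∂wienerPaths N ∂volume :=
      lintegral_mono fun X => lintegral_mono fun ω => mul_le_mul' le_rfl (min_le_left _ _)
    have hfin : ENNReal.ofReal t * P + ENNReal.ofReal (t * (3 * M * G *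
        (Real.sqrt 2 * ((3 * N : ℕ) * (2 * Real.sqrt t))))) * IV ≠ ⊤ :=
      ENNReal.add_ne_top.2 ⟨ENNReal.mul_ne_top ENNReal.ofReal_ne_top hpot,
        ENNReal.mul_ne_top ENNReal.ofReal_ne_top hIV⟩
    have := ENNReal.toReal_mono hfin
      (hmin.trans (lintegral_potential_term_le_of_integrable hv hL hψm hper hM hG hLip ht))
    rw [ENNReal.toReal_add (ENNReal.mul_ne_top ENNReal.ofReal_ne_top hpot)
      (ENNReal.mul_ne_top ENNReal.ofReal_ne_top hIV), ENNReal.toReal_mul, ENNReal.toReal_mul,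
      ENNReal.toReal_ofReal ht'.le, ENNReal.toReal_ofReal (by positivity)] at this
    have heq : t * (3 * M * G * (Real.sqrt 2 * ((3 * N : ℕ) * (2 * Real.sqrt t)))) * IV.toReal =
        K * (t * Real.sqrt t) := by
      simp only [hK, hc]; ring
    linarith
  -- conclude
  have h3 : K * (t * Real.sqrt t) ≤ t * ε :=
    calc K * (t * Real.sqrt t) = t * (K * Real.sqrt t) := by ring
      _ ≤ t * ε := mul_le_mul_of_nonneg_left hKε ht'.le
  calc (∫ X in cellN N L, ψ X ^ 2) - ∫ X in cellN N L, ψ X * pfkReal v L t ψ X ≤ _ := hpair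
    _ ≤ t * Kin.toReal + (t * P.toReal + K * (t * Real.sqrt t)) := add_le_add h1 h2
    _ ≤ t * Kin.toReal + (t * P.toReal + t * ε) := by linarith
    _ = t * (Kin.toReal + P.toReal + ε) := by ring

end Summit.AtomisticToContinuum.BoseEinsteinCondensation.Cruxes.PeriodicIRBound.LinearPhFloorWagner

end
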